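import Literature.NumberTheory.Automorphic.OrdinaryCompletedCohomologyGL
import HarnessLib

/-!
# The two-parameter levels `U(b, c) = U^p × ∏_{v ∣ p} Iw_v(b, c)` of the Hida tower

Topic `NumberTheory/Automorphic`; namespace `Literature.NumberTheory.Automorphic.BigHeckeGLn.TameLevel`.
Vocabulary complement to `OrdinaryCompletedCohomologyGL` (tame level data `𝒰 : TameLevel n K p`, its
one-parameter Hida tower `hidaLevel r = U(r, max r 1)`, the local Iwahori levels
`iwahoriLevel n v b c = Iw_v(b, c)`), wanted for the proof of Hida's control theorem
(`hidaControl_dominantOrdinaryPoint`): Hida's lemma ([KhareThorne2017, Lemma 6.10]: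
`H(X_{U(b,c)})_ord ≅ H(X_{U(b,b)})_ord`), the control complex at level `U(c,c)` versus `U(1,c)`
([KhareThorne2017, Prop. 6.6, Lemma 6.9]) and the independence of weight at level `U(c,c)` all move
the two congruence exponents `b ≤ c` INDEPENDENTLY, which the diagonal tower `U(r)` cannot express.

* `levelAt 𝒰 Λ = U ∩ ⋂_{v ∣ p} (·)_v⁻¹ Λ_v` — the level "`U^p × ∏_{v ∣ p} Λ_v`" with prescribed
  local factors `Λ_v ≤ GL_n(K_v)` at the places above `p` (for `U` maximal above `p` this is
  literally `U^p × ∏ Λ_v` when `Λ_v ≤ GL_n(𝒪_v)`); membership, monotonicity, openness/compactness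
  (for open `Λ_v`), the Hecke-pair instance, the local embedding `ι_v(Λ_v ∩ GL_n(𝒪_v)) ≤ levelAt Λ`
  and factorizability at `v ∣ p` (`isUnramifiedLevel_levelAt`, in the sense of
  `ArithmeticQuotient.IsUnramifiedLevel`) and at the good places.
* `level 𝒰 b c = U(b, c) := levelAt (Iw_v(b, c))_v` — the good subgroups `U(b, c)` of
  [KhareThorne2017, §6.3] (= `K(b, c)` of [AllenCalegariCaraianiGeeEtAl2023, §5.1]); the diagonal
  tower is `hidaLevel r = level r (max r 1)` (`hidaLevel_eq_level`, definitional); antitone in both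
  parameters; compact open.

## References

* C. Khare, J. A. Thorne, *Potential automorphy and the Leopoldt conjecture*, Amer. J. Math. 139
  (2017), §6.3 (definition of `U(b, c)`) (arXiv:1409.7007, held; read 2026-08-16). [KhareThorne2017]
* P. Allen, F. Calegari, A. Caraiani, T. Gee et al., *Potential automorphy over CM fields*,
  Ann. of Math. 197 (2023), §2.2.2, §5.1 (`K(b,c)`). [AllenCalegariCaraianiGeeEtAl2023]
-/

noncomputable section

open scoped NumberField
open IsDedekindDomain

namespace Literature.NumberTheory.Automorphic.BigHeckeGLn.TameLevel

variable {n : ℕ} {K : Type} [Field K] [NumberField K] {p : ℕ} [Fact p.Prime] (𝒰 : TameLevel n K p)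

/-! ### Levels with prescribed factors above `p` -/

/-- **The level `U^p × ∏_{v ∣ p} Λ_v`** of the tame level `𝒰` with prescribed local factors
`Λ = (Λ_v)_{v ∣ p}`, `Λ_v ≤ GL_n(K_v)`: the elements `u ∈ U` with `u_v ∈ Λ_v` for every `v ∣ p`.
For `U` maximal above `p` (`IsMaximalAbove`: `U = U^p × ∏_{v ∣ p} GL_n(𝒪_v)`) and
`Λ_v ≤ GL_n(𝒪_v)` this is the product group `U^p × ∏_{v ∣ p} Λ_v`, the general shape of the level
subgroups `U = ∏_v U_v` varied at `p` in [cite: KhareThorne2017, §6.2–6.3]. -/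
def levelAt (Λ : ∀ v : {v : HeightOneSpectrum (𝓞 K) // (p : 𝓞 K) ∈ v.asIdeal},
    Subgroup (GL (Fin n) (v.1.adicCompletion K))) : Subgroup (FiniteAdelicGL n K) :=
  𝒰.subgroup ⊓ ⨅ v, (Λ v).comap (localComponent n K v.1)

variable {Λ Λ' : ∀ v : {v : HeightOneSpectrum (𝓞 K) // (p : 𝓞 K) ∈ v.asIdeal},
  Subgroup (GL (Fin n) (v.1.adicCompletion K))}

variable (Λ) in
/-- Membership in `levelAt Λ` (definitional). [folklore] -/
theorem mem_levelAt_iff (u : FiniteAdelicGL n K) :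
    u ∈ 𝒰.levelAt Λ ↔ u ∈ 𝒰.subgroup ∧
      ∀ (w : HeightOneSpectrum (𝓞 K)) (hw : (p : 𝓞 K) ∈ w.asIdeal), localComponent n K w u ∈ Λ ⟨w, hw⟩ := by
  simp only [levelAt, Subgroup.mem_inf, Subgroup.mem_iInf, Subgroup.mem_comap, Subtype.forall]

variable (Λ) in
/-- `levelAt Λ ≤ U`. [folklore] -/
theorem levelAt_le : 𝒰.levelAt Λ ≤ 𝒰.subgroup :=
  inf_le_left

/-- `levelAt` is monotone in the local factors. [folklore] -/
theorem levelAt_mono (h : ∀ v, Λ v ≤ Λ' v) : 𝒰.levelAt Λ ≤ 𝒰.levelAt Λ' :=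
  inf_le_inf_left _ (iInf_mono fun v => Subgroup.comap_mono (h v))

variable (Λ) in
/-- `levelAt Λ` is open when the local factors are. [folklore] -/
theorem isOpen_levelAt (hΛ : ∀ v, IsOpen (Λ v : Set (GL (Fin n) (v.1.adicCompletion K)))) :
    IsOpen (𝒰.levelAt Λ : Set (FiniteAdelicGL n K)) := by
  rw [levelAt, Subgroup.coe_inf, Subgroup.coe_iInf]
  haveI : Finite {v : HeightOneSpectrum (𝓞 K) // (p : 𝓞 K) ∈ v.asIdeal} :=
    finite_setOf_natCast_mem_asIdeal K p
  refine 𝒰.isOpen.inter (isOpen_iInter_of_finite fun v => ?_)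
  rw [Subgroup.coe_comap]
  exact (hΛ v).preimage (continuous_localComponent n K _)

variable (Λ) in
/-- `levelAt Λ` is compact when the local factors are open (closed in the compact `U`). [folklore] -/
theorem isCompact_levelAt (hΛ : ∀ v, IsOpen (Λ v : Set (GL (Fin n) (v.1.adicCompletion K)))) :
    IsCompact (𝒰.levelAt Λ : Set (FiniteAdelicGL n K)) := by
  rw [levelAt, Subgroup.coe_inf, Subgroup.coe_iInf]
  refine 𝒰.isCompact.of_isClosed_subset ((Subgroup.isClosed_of_isOpen _ 𝒰.isOpen).inter
    (isClosed_iInter fun v => ?_)) Set.inter_subset_left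
  rw [Subgroup.coe_comap]
  exact (Subgroup.isClosed_of_isOpen _ (hΛ v)).preimage (continuous_localComponent n K _)

variable (Λ) in
/-- `levelAt Λ` is a Hecke subgroup (compact open) when the local factors are open. [folklore] -/
theorem isHeckeTriple_levelAt (hΛ : ∀ v, IsOpen (Λ v : Set (GL (Fin n) (v.1.adicCompletion K)))) :
    IsHeckeTriple (⊤ : Submonoid (FiniteAdelicGL n K)) (𝒰.levelAt Λ) (𝒰.levelAt Λ) :=
  isHeckeTriple_top_of_isCompact_isOpen _ (𝒰.isCompact_levelAt Λ hΛ) (𝒰.isOpen_levelAt Λ hΛ)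

/-- **Local elements in `levelAt Λ`** (`U` maximal above `p`): `ι_v(g) ∈ levelAt Λ` for
`g ∈ Λ_v ∩ GL_n(𝒪_v)`. [folklore] -/
theorem ofLocal_mem_levelAt (h𝒰 : 𝒰.IsMaximalAbove) {v : HeightOneSpectrum (𝓞 K)}
    (hv : (p : 𝓞 K) ∈ v.asIdeal) {g : GL (Fin n) (v.adicCompletion K)}
    (hg₁ : g ∈ valuedCongruenceSubgroup (Fin n) (1 : WithZero (Multiplicative ℤ)))
    (hgΛ : g ∈ Λ ⟨v, hv⟩) : ofLocal n K v g ∈ 𝒰.levelAt Λ := by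
  rw [mem_levelAt_iff]
  refine ⟨h𝒰.ofLocal_mem v hv g hg₁, fun w hw => ?_⟩
  by_cases hwv : w = v
  · subst hwv
    rwa [localComponent_ofLocal]
  · rw [localComponent_ofLocal_of_ne hwv]
    exact one_mem _

variable {𝒰} in
/-- **Changing the `v`-component inside `U`** (`U` maximal above `p`, `v ∣ p`): for `u ∈ U` and
integral `z ∈ GL_n(𝒪_v)`, the element `u · ι_v(u_v)⁻¹ · ι_v(z)` (same components off `v`,
`v`-component `z`) lies in `U`. [folklore] -/
theorem IsMaximalAbove.mul_ofLocal_inv_mul_ofLocal_mem (h𝒰 : 𝒰.IsMaximalAbove)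
    {v : HeightOneSpectrum (𝓞 K)} (hv : (p : 𝓞 K) ∈ v.asIdeal) {u : FiniteAdelicGL n K}
    (hu : u ∈ 𝒰.subgroup) {z : GL (Fin n) (v.adicCompletion K)}
    (hz : z ∈ valuedCongruenceSubgroup (Fin n) (1 : WithZero (Multiplicative ℤ))) :
    u * (ofLocal n K v (localComponent n K v u))⁻¹ * ofLocal n K v z ∈ 𝒰.subgroup :=
  mul_mem (h𝒰.mul_ofLocal_inv_mem v hv u hu) (h𝒰.ofLocal_mem v hv z hz)

/-- **Changing the `v`-component inside `levelAt`** (`U` maximal above `p`, `v ∣ p`): for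
`u ∈ levelAt Λ`, integral `z ∈ Λ'_v`, and `Λ_w ≤ Λ'_w` off `v`, the element `u ι_v(u_v)⁻¹ ι_v(z)`
lies in `levelAt Λ'`. [folklore] -/
theorem mul_ofLocal_inv_mul_ofLocal_mem_levelAt (h𝒰 : 𝒰.IsMaximalAbove)
    {v : HeightOneSpectrum (𝓞 K)} (hv : (p : 𝓞 K) ∈ v.asIdeal) {u : FiniteAdelicGL n K}
    (hu : u ∈ 𝒰.levelAt Λ) {z : GL (Fin n) (v.adicCompletion K)}
    (hz₁ : z ∈ valuedCongruenceSubgroup (Fin n) (1 : WithZero (Multiplicative ℤ)))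
    (hzΛ : z ∈ Λ' ⟨v, hv⟩) (hΛ : ∀ w : {w : HeightOneSpectrum (𝓞 K) // (p : 𝓞 K) ∈ w.asIdeal},
      w.1 ≠ v → Λ w ≤ Λ' w) :
    u * (ofLocal n K v (localComponent n K v u))⁻¹ * ofLocal n K v z ∈ 𝒰.levelAt Λ' := by
  rw [mem_levelAt_iff] at hu ⊢
  refine ⟨h𝒰.mul_ofLocal_inv_mul_ofLocal_mem hv hu.1 hz₁, fun w hw => ?_⟩
  rw [map_mul, map_mul, map_inv]
  by_cases hwv : w = v
  · subst hwv
    rwa [localComponent_ofLocal, localComponent_ofLocal, mul_inv_cancel, one_mul]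
  · rw [localComponent_ofLocal_of_ne hwv, localComponent_ofLocal_of_ne hwv, inv_one, mul_one,
      mul_one]
    exact hΛ ⟨w, hw⟩ hwv (hu.2 w hw)

/-- Conjugation of a finite-adelic element by a local element `ι_v(g)`: the `v`-deprived part of `y`
times `ι_v(g⁻¹ y_v g)` (cf. `ofLocal_inv_mul_mul_ofLocal` of `CompletedCohomologyActionGL`, outside
this file's import cone). [folklore] -/
theorem ofLocal_inv_mul_mul_ofLocal_eq (v : HeightOneSpectrum (𝓞 K))
    (g : GL (Fin n) (v.adicCompletion K)) (y : FiniteAdelicGL n K) :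
    (ofLocal n K v g)⁻¹ * y * ofLocal n K v g =
      y * (ofLocal n K v (localComponent n K v y))⁻¹ *
        ofLocal n K v (g⁻¹ * localComponent n K v y * g) := by
  refine ext_localComponent fun w => ?_
  by_cases hw : w = v
  · subst hw
    simp only [map_mul, map_inv, localComponent_ofLocal]
    rw [mul_inv_cancel, one_mul]
  · simp only [map_mul, map_inv, localComponent_ofLocal_of_ne hw, inv_one, one_mul, mul_one]

/-- **Conjugation by a local element preserves `levelAt` as soon as it preserves the local factor**
(`U` maximal above `p`, `v ∣ p`, `Λ_v ≤ GL_n(𝒪_v)`): if `y ∈ levelAt Λ` and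
`g⁻¹ y_v g ∈ Λ_v` then `ι_v(g)⁻¹ y ι_v(g) ∈ levelAt Λ`. [folklore] -/
theorem ofLocal_inv_mul_mul_ofLocal_mem_levelAt (h𝒰 : 𝒰.IsMaximalAbove)
    {v : HeightOneSpectrum (𝓞 K)} (hv : (p : 𝓞 K) ∈ v.asIdeal)
    (hΛv : Λ ⟨v, hv⟩ ≤ valuedCongruenceSubgroup (Fin n) (1 : WithZero (Multiplicative ℤ)))
    {y : FiniteAdelicGL n K} (hy : y ∈ 𝒰.levelAt Λ) {g : GL (Fin n) (v.adicCompletion K)}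
    (hg : g⁻¹ * localComponent n K v y * g ∈ Λ ⟨v, hv⟩) :
    (ofLocal n K v g)⁻¹ * y * ofLocal n K v g ∈ 𝒰.levelAt Λ := by
  rw [ofLocal_inv_mul_mul_ofLocal_eq]
  exact 𝒰.mul_ofLocal_inv_mul_ofLocal_mem_levelAt h𝒰 hv hy (hΛv hg) hg fun _ _ => le_rfl

/-- **`levelAt Λ` is factorizable at `v ∣ p` with local factor `Λ_v`** (`U` maximal above `p`,
`Λ_v ≤ GL_n(𝒪_v)`), in the sense of `ArithmeticQuotient.IsUnramifiedLevel`. [folklore] -/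
theorem isUnramifiedLevel_levelAt (h𝒰 : 𝒰.IsMaximalAbove) {v : HeightOneSpectrum (𝓞 K)}
    (hv : (p : 𝓞 K) ∈ v.asIdeal)
    (hΛv : Λ ⟨v, hv⟩ ≤ valuedCongruenceSubgroup (Fin n) (1 : WithZero (Multiplicative ℤ))) :
    ArithmeticQuotient.IsUnramifiedLevel (Λ ⟨v, hv⟩) (ofLocal n K v) (localComponent n K v)
      (𝒰.levelAt Λ) where
  apply_apply := localComponent_ofLocal
  comm_of_apply_eq_one _ hx := mul_ofLocal_comm hx
  map_le := by
    rintro _ ⟨g, hg, rfl⟩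
    exact 𝒰.ofLocal_mem_levelAt h𝒰 hv (hΛv hg) hg
  le_comap u hu := ((𝒰.mem_levelAt_iff Λ u).1 hu).2 v hv

variable (Λ) in
/-- **`levelAt Λ` is unramified at every good place `w ∉ S`** (its `w`-factor is `GL_n(𝒪_w)`).
[folklore] -/
theorem isUnramifiedLevel_levelAt_of_not_mem {w : HeightOneSpectrum (𝓞 K)} (hw : w ∉ 𝒰.bad) :
    ArithmeticQuotient.IsUnramifiedLevel (valuedCongruenceSubgroup (Fin n)
      (1 : WithZero (Multiplicative ℤ))) (ofLocal n K w) (localComponent n K w) (𝒰.levelAt Λ) := by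
  refine isUnramifiedLevel_of_le ?_ fun u hu =>
    localComponent_mem_valuedCongruenceSubgroup_one (𝒰.le_glFiniteIntegralLevel (𝒰.levelAt_le Λ hu)) w
  rintro _ ⟨g, hg, rfl⟩
  rw [mem_levelAt_iff]
  refine ⟨𝒰.ofLocal_mem w hw g hg, fun w' hw' => ?_⟩
  have hne : w' ≠ w := fun h => hw (𝒰.mem_bad_of_mem w (h ▸ hw'))
  rw [localComponent_ofLocal_of_ne hne]
  exact one_mem _

/-! ### The two-parameter Hida levels `U(b, c)` -/

/-- **The level `U(b, c)` of the Hida tower**: `u ∈ U` with `u_v ∈ Iw_v(b, c)` for every `v ∣ p`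
(`u_v` upper triangular modulo `ϖ_v^{max b c}` and with diagonal entries `≡ 1` modulo `ϖ_v^b`) — the
good subgroups `U(b, c) = U^p × ∏_{v ∈ S_p} I_v(b, c)` of [cite: KhareThorne2017, §6.3]
(`K(b, c)` of [cite: AllenCalegariCaraianiGeeEtAl2023, §5.1]), of which the diagonal tower
`hidaLevel r = U(r, max r 1)` is a special case (`hidaLevel_eq_level`). -/
def level (b c : ℕ) : Subgroup (FiniteAdelicGL n K) :=
  𝒰.levelAt fun v => iwahoriLevel n v.1 b c

/-- Membership in `U(b, c)` (definitional). [folklore] -/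
theorem mem_level_iff (b c : ℕ) (u : FiniteAdelicGL n K) :
    u ∈ 𝒰.level b c ↔ u ∈ 𝒰.subgroup ∧ ∀ w : HeightOneSpectrum (𝓞 K), (p : 𝓞 K) ∈ w.asIdeal →
      localComponent n K w u ∈ iwahoriLevel n w b c :=
  𝒰.mem_levelAt_iff _ u

/-- **The diagonal Hida tower inside the two-parameter family: `U(r) = U(r, max r 1)`**
(definitional). [folklore] -/
theorem hidaLevel_eq_level (r : ℕ) : 𝒰.hidaLevel r = 𝒰.level r (max r 1) :=
  rfl

/-- `U(b, c) ≤ U`. [folklore] -/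
theorem level_le (b c : ℕ) : 𝒰.level b c ≤ 𝒰.subgroup :=
  𝒰.levelAt_le _

/-- The `U(b, c)` decrease in both parameters. [folklore] -/
theorem level_antitone {b b' c c' : ℕ} (hb : b ≤ b') (hc : c ≤ c') : 𝒰.level b' c' ≤ 𝒰.level b c :=
  𝒰.levelAt_mono fun v => iwahoriLevel_antitone v.1 hb hc

/-- `U(b, c)` is open. [folklore] -/
theorem isOpen_level (b c : ℕ) : IsOpen (𝒰.level b c : Set (FiniteAdelicGL n K)) :=
  𝒰.isOpen_levelAt _ fun v => isOpen_iwahoriLevel v.1 b c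

/-- `U(b, c)` is compact. [folklore] -/
theorem isCompact_level (b c : ℕ) : IsCompact (𝒰.level b c : Set (FiniteAdelicGL n K)) :=
  𝒰.isCompact_levelAt _ fun v => isOpen_iwahoriLevel v.1 b c

/-- `U(b, c)` is a Hecke subgroup of `GL_n(𝔸_K^∞)` (compact open). [folklore] -/
instance isHeckeTriple_level (b c : ℕ) :
    IsHeckeTriple (⊤ : Submonoid (FiniteAdelicGL n K)) (𝒰.level b c) (𝒰.level b c) :=
  𝒰.isHeckeTriple_levelAt _ fun v => isOpen_iwahoriLevel v.1 b c

/-- **`U(b, c)` is factorizable at `v ∣ p` with local factor `Iw_v(b, c)`** (`U` maximal above `p`).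
[cite: KhareThorne2017, §6.3] -/
theorem isUnramifiedLevel_level (h𝒰 : 𝒰.IsMaximalAbove) (b c : ℕ) {v : HeightOneSpectrum (𝓞 K)}
    (hv : (p : 𝓞 K) ∈ v.asIdeal) :
    ArithmeticQuotient.IsUnramifiedLevel (iwahoriLevel n v b c) (ofLocal n K v) (localComponent n K v)
      (𝒰.level b c) :=
  𝒰.isUnramifiedLevel_levelAt (Λ := fun w => iwahoriLevel n w.1 b c) h𝒰 hv
    valuedIwahoriSubgroup_le_valuedCongruenceSubgroup_one

/-- `U(b, c)` is unramified at every good place. [folklore] -/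
theorem isUnramifiedLevel_level_of_not_mem (b c : ℕ) {w : HeightOneSpectrum (𝓞 K)} (hw : w ∉ 𝒰.bad) :
    ArithmeticQuotient.IsUnramifiedLevel (valuedCongruenceSubgroup (Fin n)
      (1 : WithZero (Multiplicative ℤ))) (ofLocal n K w) (localComponent n K w) (𝒰.level b c) :=
  𝒰.isUnramifiedLevel_levelAt_of_not_mem _ hw

end Literature.NumberTheory.Automorphic.BigHeckeGLn.TameLevel
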